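import Literature.Geometry.Lorentzian.KerrBoyerLindquistSliceIngoing
import HarnessLib

/-!
# The Boyer–Lindquist slice of Kerr through the ingoing chart, II: the unit normal in
# coordinates

Support file (all results proved), continuing `KerrBoyerLindquistSliceIngoing.lean`. In the ingoing
Kerr coordinates `u = (t*, r, μ, φ)` the future unit normal of the Boyer–Lindquist slice `{t = 0}`
is `n = α⁻¹ (∂_{t*} + ω ∂_φ)` with the frame-dragging angular velocity `ω = 2Mar/A = −β^φ` and the
Boyer–Lindquist lapse `α = √(ΔΣ/A)` (`A = (r² + a²)Σ + 2Mra² sin²θ`): indeed `∂_{t_BL} = ∂_{t*}`,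
`∂_{φ_BL} = ∂_φ` as vector fields, and `n = α⁻¹(∂_t − β^φ ∂_φ)` in Boyer–Lindquist form. This file
records `ω` (`blOmega`), `N₀ = ∂_{t*} + ω ∂_φ` (`blNormal0`), `α` (`blLapse`) and `n = N₀/α`
(`blNormal`), and proves, in the rational component field `Kerr.Ingoing.bilin`:

* `bilin_blNormal0_blLift` — **`N₀` is normal to the slice**: `g(N₀, blLift(ṙ, μ̇, φ̇)) = 0`;
* `bilin_blNormal0_self` — `g(N₀, N₀) = −ΔΣ/A`;
* `bilin_blNormal_blLift`, `bilin_blNormal_self` — `g(n, ·)|_{T(slice)} = 0`, `g(n, n) = −1`;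
* `blA_pos`, `blLapse_pos`, `blNormal_apply_zero` (`n⁰ = α⁻¹ > 0`: `n` is future for `−g♯dt*`).

References: Boyer–Lindquist 1967; Bardeen–Press–Teukolsky, ApJ 178 (1972) 347, (2.3)–(2.5)
(lapse, shift `ω = 2Mar/A` of the Boyer–Lindquist slicing); Brandt–Seidel, Phys. Rev. D 54 (1996)
1403, §II; Visser arXiv:0706.0622, (E:BL1)–(E:BL3).
-/

noncomputable section

open Set Function

namespace Literature.Geometry.Lorentzian

namespace Kerr.Ingoing

variable {M a : ℝ} {u : E4}

/-! ### The angular velocity, the unnormalised normal, the lapse -/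

/-- **The frame-dragging angular velocity** `ω = 2Mra/A` of the Boyer–Lindquist slice normal
(`= −β^φ`). Bardeen–Press–Teukolsky 1972, (2.3); Visser arXiv:0706.0622, (E:BL3). [cite: arXiv07060622, §5] -/
def blOmega (M a : ℝ) (u : E4) : ℝ :=
  2 * M * u 1 * a / blA M a u

/-- **The unnormalised normal** `N₀ = ∂_{t*} + ω ∂_φ` of the Boyer–Lindquist slice in ingoing Kerr
coordinates. Bardeen–Press–Teukolsky 1972, (2.5). [cite: arXiv07060622, §5] -/
def blNormal0 (M a : ℝ) (u : E4) : E4 :=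
  WithLp.toLp 2 ![1, 0, 0, blOmega M a u]

/-- Components. [cite: arXiv07060622, §5] -/
@[simp] theorem blNormal0_apply_zero (M a : ℝ) (u : E4) : blNormal0 M a u 0 = 1 := rfl

/-- Components. [cite: arXiv07060622, §5] -/
@[simp] theorem blNormal0_apply_one (M a : ℝ) (u : E4) : blNormal0 M a u 1 = 0 := rfl

/-- Components. [cite: arXiv07060622, §5] -/
@[simp] theorem blNormal0_apply_two (M a : ℝ) (u : E4) : blNormal0 M a u 2 = 0 := rfl

/-- Components. [cite: arXiv07060622, §5] -/
@[simp] theorem blNormal0_apply_three (M a : ℝ) (u : E4) : blNormal0 M a u 3 = blOmega M a u := rfl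

/-- **`A > 0`** for `M ≥ 0`, `r > 0`, `Σ > 0`, `sin²θ ≥ 0`. [cite: arXiv07060622, §5] -/
theorem blA_pos (hM : 0 ≤ M) (hr : 0 < u 1) (hS : 0 < sigma a u) (hs : 0 ≤ sinSq u) :
    0 < blA M a u := by
  unfold blA
  have h1 : 0 < (u 1 ^ 2 + a ^ 2) * sigma a u := by positivity
  have h2 : 0 ≤ 2 * M * u 1 * a ^ 2 * sinSq u := by positivity
  linarith

/-- **`N₀` is normal to the Boyer–Lindquist slice**: `g_u(N₀, blLift(ṙ, μ̇, φ̇)) = 0` (`Δ, Σ, A ≠ 0`).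
Bardeen–Press–Teukolsky 1972, (2.5); Boyer–Lindquist 1967. [cite: arXiv07060622, §5] -/
theorem bilin_blNormal0_blLift (hΔ : delta M a (u 1) ≠ 0) (hS : sigma a u ≠ 0) (hA : blA M a u ≠ 0)
    (rdot mdot pdot : ℝ) :
    bilin M a u (blNormal0 M a u) (blLift M a (u 1) rdot mdot pdot) = 0 := by
  set D := delta M a (u 1) with hD
  set S := sigma a u with hS'
  set A := blA M a u with hA'
  rw [bilin_apply]
  simp only [blNormal0_apply_zero, blNormal0_apply_one, blNormal0_apply_two, blNormal0_apply_three,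
    blLift_apply_zero, blLift_apply_one, blLift_apply_two, blLift_apply_three, blSlopeT, blSlopePhi,
    blOmega, c13, c33, h00, h03, scalarH]
  rw [← hD, ← hS', ← hA']
  field_simp
  rw [hD, hS', hA']
  unfold blA delta sigma sinSq
  ring

/-- **`g(N₀, N₀) = −ΔΣ/A`** (`Σ, A ≠ 0`). Bardeen–Press–Teukolsky 1972, (2.3) (`α² = ΔΣ/A`).
[cite: arXiv07060622, §5] -/
theorem bilin_blNormal0_self (hS : sigma a u ≠ 0) (hA : blA M a u ≠ 0) :
    bilin M a u (blNormal0 M a u) (blNormal0 M a u) = -(delta M a (u 1) * sigma a u / blA M a u) := by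
  set S := sigma a u with hS'
  set A := blA M a u with hA'
  rw [bilin_apply]
  simp only [blNormal0_apply_zero, blNormal0_apply_one, blNormal0_apply_two, blNormal0_apply_three,
    blOmega, c13, c33, h00, h03, scalarH]
  rw [← hS', ← hA']
  field_simp
  rw [hS', hA']
  unfold blA delta sigma sinSq
  ring

/-- **The Boyer–Lindquist lapse** `α = √(ΔΣ/A)`. Bardeen–Press–Teukolsky 1972, (2.3).
[cite: arXiv07060622, §5] -/
def blLapse (M a : ℝ) (u : E4) : ℝ :=
  √(delta M a (u 1) * sigma a u / blA M a u)

/-- The lapse is positive where `Δ, Σ, A > 0`. [cite: arXiv07060622, §5] -/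
theorem blLapse_pos (hΔ : 0 < delta M a (u 1)) (hS : 0 < sigma a u) (hA : 0 < blA M a u) :
    0 < blLapse M a u :=
  Real.sqrt_pos.2 (by positivity)

/-- **The future unit normal of the Boyer–Lindquist slice in ingoing Kerr coordinates**:
`n = α⁻¹(∂_{t*} + ω ∂_φ)`. Bardeen–Press–Teukolsky 1972, (2.5). [cite: arXiv07060622, §5] -/
def blNormal (M a : ℝ) (u : E4) : E4 :=
  (blLapse M a u)⁻¹ • blNormal0 M a u

/-- `n⁰ = α⁻¹`. [cite: arXiv07060622, §5] -/
theorem blNormal_apply_zero (M a : ℝ) (u : E4) : blNormal M a u 0 = (blLapse M a u)⁻¹ := by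
  simp [blNormal]

/-- **`n` is normal to the slice**: `g_u(n, blLift(ṙ, μ̇, φ̇)) = 0`. [cite: arXiv07060622, §5] -/
theorem bilin_blNormal_blLift (hΔ : delta M a (u 1) ≠ 0) (hS : sigma a u ≠ 0) (hA : blA M a u ≠ 0)
    (rdot mdot pdot : ℝ) :
    bilin M a u (blNormal M a u) (blLift M a (u 1) rdot mdot pdot) = 0 := by
  simp only [blNormal, map_smul, FunLike.coe_smul, Pi.smul_apply, smul_eq_mul,
    bilin_blNormal0_blLift hΔ hS hA, mul_zero]

/-- **`n` is a timelike unit vector**: `g_u(n, n) = −1` (`Δ, Σ, A > 0`). [cite: arXiv07060622, §5] -/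
theorem bilin_blNormal_self (hΔ : 0 < delta M a (u 1)) (hS : 0 < sigma a u) (hA : 0 < blA M a u) :
    bilin M a u (blNormal M a u) (blNormal M a u) = -1 := by
  have hq : 0 < delta M a (u 1) * sigma a u / blA M a u := by positivity
  have key : (blLapse M a u)⁻¹ * ((blLapse M a u)⁻¹ *
      -(delta M a (u 1) * sigma a u / blA M a u)) = -1 := by
    rw [← mul_assoc, ← pow_two, inv_pow, blLapse, Real.sq_sqrt hq.le, mul_neg,
      inv_mul_cancel₀ hq.ne']
  simp only [blNormal, map_smul, FunLike.coe_smul, Pi.smul_apply, smul_eq_mul,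
    bilin_blNormal0_self hS.ne' hA.ne']
  exact key

end Kerr.Ingoing

end Literature.Geometry.Lorentzian

end
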